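import Summits.ABC.IUTFork.Repair.RHQ3LTailSigma15
import Summits.ABC.IUTFork.Repair.RHQ3LTailUniformHeavy
import Literature.IUT.LogVolume.UnitLogTorsionFreeBallCriterion
import HarnessLib

/-!
# D-0079 RESCUE sub-cell R-H, ROUND 2 Q3 — row 15 «slotreach» (the family head Σ₁₅ ⊋ Σ₈): «NOT UNIFORMLY» IN KERNEL, UNCONDITIONALLY
# (seat abc-iut-rh2-q3-typ-1 g4)

PROOF-ONLY file (D-0012; 0 definitions, 0 `Prop` facts, no instance, no notation). Rung LADDER-ABC:A2.RESCUE.H, director charge (10)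
«type `∃ l₀, ∀ l ≥ l₀, every genuine admissible datum lies in Σ_row` per kept row as kernel targets — prove or refute». Row 15's per-CURVE
reading is PROVED (`RH.Q3LTailSigma15.lTailSigma15_holds`, p481995: `∀ (F, E) ∃ l₀(E) ∀ l ≥ l₀ ∀ Def-3.1 data with K/ℚ Galois, certified
row-15 parameters `(m_q, n₀, λ)` with abc-iut-rh-typ-12's `RHSlotReach.SlotReachWindowK` exist»). THIS FILE refutes the UNIFORM reading, i.e. the
same sentence with `∃ l₀` moved in front of `∀ (F, E)`, with NO hypothesis — for Galois data (**`not_exists_uniform_l0_slotReachWindowK_isGalois`**,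
the literal uniformisation of `LTailSigma15`; the unguarded reading over ALL data follows a fortiori); `perCurve_and_not_uniform` records both
halves side by side. Since Σ₈ ⊆ Σ₁₅ AT THE DATUM (abc-iut-rh2-q2-hull `RH2SigmaHullRow8.exists_certifiedWindow_of_hBand`, in kernel),
this is the strongest «not uniformly» of the datum rows typed so far (it implies the row-8 statements of p489180 / p493238 in substance).

THE NEW LEMMA (why a heavy TAME place is outside Σ₁₅ whatever the certificates). The row-15 window at a bad place `w ∣ p`, label `j = i+1`, donors
`x₀,…,x_i ∣ p` reads `⌊(j²·m_q − n₀(w))/e_w⌋ ≤ m_q/e_w + λ_w + Σ_a (λ_{x_a} + ⌈n₀(x_a)/e_{x_a}⌉)`, the dictionary `(n₀, λ)` being CERTIFIED: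
`n₀(x)` by a NON-member `u ∉ log_p 𝒪_x^×` with `‖u‖ ≤ p^{−(n₀−1)/e_x}`, `λ_x` by a MEMBER `z ∈ log_p 𝒪_x^×` with `p^{λ_x} ≤ ‖z‖` ([IUTchIV] Prop. 1.2 (i),
Prop. 1.4 (ii)). At a TAME place (`p > 2`, `e_x ≤ p − 2`) the log shell is EXACTLY `𝔪_x` (campaign-S / abc-iut-w6-d060
`TorsionFree.logUnits_eq_closedBall_of_le_sub_two`, [IUTchIV] Prop. 1.2 (i) equality clause), so EVERY certificate has `n₀(x) ≤ 1` and
`λ_x ≤ −1/e_x` (§1). Taking all donors equal to `w` the window at label `j` then forces `(j−1)·m_q(w) ≤ e_w − 1` (§2, integer arithmetic), while at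
the genuine `K`-level datum `2l·m_q(w) = e(w|v)·ord_v(q_v)` and `e_w = e(w|v)·e(v|p)` ([IUTchI] Ex. 3.2 (iv), `Cor312Prov.exists_nat_qPilot_pilotDataOfK`),
so the top label `j = l⋆ = (l−1)/2` is OUTSIDE as soon as `4·l·e(v|p) ≤ (l−3)·ord_v(q_v)` — local height `H_v = ord_v(q_v)/e(v|p) ≥ 4l/(l−3)`,
e.g. `H_v ≥ 5` for every `l ≥ 15` (§3 `not_slotReachWindowK_of_heavy_tame`). The witness family is this lineage's (g3, p488771/p489180/p493238):
prime `l ≡ 3 (mod 4)`, `l > max(l₀, 160)` (Dirichlet); prime `r ∈ (30l+1, 60l+2]` (Bertrand; `+1` so that `e_{x₀} ≤ 30l ≤ r − 2` is TAME in the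
above sense); `λ_r = r⁸/(r⁸+1)` with (P2), (P5), (P6) theorems; the Galois datum of `UniformWitness.exists_thetaVolumeDatumAt_isGalois`; its bad place
over `r` (`UniformWitness.exists_heavy_place_ratPoint_of_pole`: `e_{x₀} ≤ 30·l`, `ord_v(q_v) = 16·e(v|r)`), where `4l ≤ 16(l−3)`.

READING (numbers, no side). «Q3 (row 15): YES PER CURVE (Galois data), NOT UNIFORMLY» — both halves kernel theorems, no existence input; the
NOT-UNIFORM half does not even need the exponential `l₀` scale: ONE tame place of local height `≥ 5` at level `l` defeats every certificate.
Nothing here asserts abc or takes a side on [IUTchIII] Cor. 3.12 or on any author; `SlotReachWindowK` (abc-iut-lens-wuc-1 / abc-iut-rh-typ-12) is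
row 15's HYPOTHESIS vocabulary about OUR typed objects; the Θ-data are the tree's interface inhabitants (`ThetaPartII.stub_thetaData` lineage) exactly
as in every R-W refutation of record; refuted-as-typed ≠ refuted-in-print; typed ≠ proved.
[cite: Mochizuki2012, IUTchI Def. 3.1 (b)(c) pp. 61–62, Ex. 3.2 (iv) p. 71; IUTchIV Prop. 1.2 (i) p. 10, Prop. 1.4 (ii) p. 13, Cor. 2.2 (ii) proof
(P2)(P5)(P6)(P7) pp. 45–46] [cite: NeukirchANT1999, Ch. II Prop. (5.5)] [cite: DupuyHilado2025, §3.9, §4.9] [claim: Mochizuki2012, status: disputed]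
for every IUT locution.
-/

noncomputable section

open Set Function NumberField IsDedekindDomain Metric

namespace Summit.ABC.IUTFork.Repair.RH.Q3LTailSigma15

open Literature.IUT.LogThetaLattice Literature.IUT.LogVolume Literature.IUT.HodgeTheaters
open Literature.IUT.LogVolume.ThetaData Literature.IUT.LogVolume.Cor22
open Summit.ABC.IUTFork.Thm311 Summit.ABC.IUTFork.Thm311.Real Summit.ABC.IUTFork.Cor312Prov Summit.ABC.IUTFork.Repair.RHSlotReach
open Literature.NumberTheory.NumberFields Literature.NumberTheory.GaloisRepresentations.Ultrametric
  Literature.NumberTheory.DiophantineGeometry Literature.NumberTheory.DiophantineGeometry.GenEll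
  Literature.NumberTheory.DiophantineGeometry.UniformABCConjecture Rat.HeightOneSpectrum Summit.ABC.ABC.Theorems Summit.ABC.IUTFork.Conditional
  Summit.ABC.IUTFork.Repair.RH.Q3LTailSigma8.UniformWitness

namespace Uniform

/-! ## §1. At a TAME completion every certificate pins the dictionary: `n₀ ≤ 1` and `λ ≤ −1/e` -/

section Local

variable (p : ℕ) [Fact p.Prime] {L : Type*} [NontriviallyNormedField L] [NormedAlgebra ℚ_[p] L] [IsUltrametricDist L] [ProperSpace L]

/-- **Inner-conductor certificates are `≤ 1` at a tame place.** `p > 2`, `e(L/ℚ_p) ≤ p − 2`: if `u ∉ log_p 𝒪_L^×` has `‖u‖ ≤ p^{−(n₀−1)/e}` then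
`n₀ ≤ 1` — for `n₀ ≥ 2` the bound says `u ∈ 𝔪_L = log_p 𝒪_L^×` ([IUTchIV] Prop. 1.2 (i), equality clause; `TorsionFree.logUnits_eq_closedBall_of_le_sub_two`).
[cite: Mochizuki2012, IUTchIV Prop. 1.2 (i) p. 10] [cite: NeukirchANT1999, Ch. II Prop. (5.5)] -/
theorem natConductor_le_one_of_tame (hp2 : 2 < p) (he : absRamificationIdx p L ≤ p - 2) {n₀ : ℕ} {u : L}
    (hu : ‖u‖ ≤ (p : ℝ) ^ (-(((n₀ : ℤ) - 1 : ℤ) : ℝ) / (absRamificationIdx p L : ℝ))) (hu' : u ∉ logUnits L) : n₀ ≤ 1 := by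
  by_contra hlt
  rw [not_le] at hlt
  apply hu'
  have hp1 : (1 : ℝ) ≤ p := by exact_mod_cast (Fact.out : p.Prime).one_lt.le
  have he0 : (0 : ℝ) < absRamificationIdx p L := by exact_mod_cast absRamificationIdx_pos p L
  rw [TorsionFree.logUnits_eq_closedBall_of_le_sub_two p (isUniformizer_unifChoice L) hp2 he, mem_closedBall_zero_iff,
    norm_eq_rpow_of_isUniformizer p L (isUniformizer_unifChoice L)]
  refine hu.trans (Real.rpow_le_rpow_of_exponent_le hp1 ?_)
  have h1 : (1 : ℝ) ≤ (((n₀ : ℤ) - 1 : ℤ) : ℝ) := by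
    have : (1 : ℤ) ≤ (n₀ : ℤ) - 1 := by omega
    exact_mod_cast this
  rw [neg_div, neg_le_neg_iff]
  gcongr

/-- **Outer-radius certificates are `≤ −1/e` at a tame place.** `p > 2`, `e(L/ℚ_p) ≤ p − 2`: if `z ∈ log_p 𝒪_L^×` has `p^λ ≤ ‖z‖` then `λ ≤ −1/e`
(`log_p 𝒪_L^× = 𝔪_L`, `‖ϖ‖ = p^{−1/e}`). [cite: Mochizuki2012, IUTchIV Prop. 1.2 (i) p. 10] [cite: NeukirchANT1999, Ch. II Prop. (5.5)] -/
theorem exponent_le_of_mem_logUnits_of_tame (hp2 : 2 < p) (he : absRamificationIdx p L ≤ p - 2) {lam : ℝ} {z : L}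
    (hz : z ∈ logUnits L) (hle : (p : ℝ) ^ lam ≤ ‖z‖) : lam ≤ -(1 / (absRamificationIdx p L : ℝ)) := by
  have hp1 : (1 : ℝ) < p := by exact_mod_cast (Fact.out : p.Prime).one_lt
  rw [TorsionFree.logUnits_eq_closedBall_of_le_sub_two p (isUniformizer_unifChoice L) hp2 he, mem_closedBall_zero_iff,
    norm_eq_rpow_of_isUniformizer p L (isUniformizer_unifChoice L)] at hz
  exact (Real.rpow_le_rpow_left_iff hp1).1 (hle.trans hz)

end Local

section Place

variable {F : Type} [Field F] [NumberField F] (X : PilotData F) (p : ℕ) [hp : Fact p.Prime]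

/-- **At a tame place `x ∣ p` of a pilot datum (`e_x = ramIdx F (placeOf x) ≤ p − 2`, `p > 2`) every inner-conductor certificate has `n₀ ≤ 1`**
(`natConductor_le_one_of_tame` at `kOf X p x`, `RHHeightClassGlue.absRamificationIdx_kOf`). [cite: Mochizuki2012, IUTchIV Prop. 1.2 (i) p. 10] -/
theorem natConductor_le_one_placeOf (hp2 : 2 < p) (x : (thetaIndex X).Fibre (.inr (ratPrime p))) (he : ramIdx F (placeOf X p x) ≤ p - 2)
    {n₀ : ℕ} (h : ∃ u : kOf X p x, ‖u‖ ≤ (p : ℝ) ^ (-(((n₀ : ℤ) - 1 : ℤ) : ℝ) / (ramIdx F (placeOf X p x) : ℝ)) ∧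
      u ∉ (logUnits (kOf X p x) : Set (kOf X p x))) : n₀ ≤ 1 := by
  obtain ⟨u, hu, hu'⟩ := h
  rw [← RHHeightClassGlue.absRamificationIdx_kOf X p x] at he hu
  exact natConductor_le_one_of_tame p hp2 he hu hu'

/-- **At a tame place `x ∣ p` of a pilot datum every outer-radius certificate has `λ ≤ −1/e_x`** (`exponent_le_of_mem_logUnits_of_tame` at
`kOf X p x`). [cite: Mochizuki2012, IUTchIV Prop. 1.2 (i) p. 10] -/
theorem exponent_le_placeOf (hp2 : 2 < p) (x : (thetaIndex X).Fibre (.inr (ratPrime p))) (he : ramIdx F (placeOf X p x) ≤ p - 2) {lam : ℝ}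
    (h : ∃ z ∈ (logUnits (kOf X p x) : Set (kOf X p x)), (p : ℝ) ^ lam ≤ ‖z‖) : lam ≤ -(1 / (ramIdx F (placeOf X p x) : ℝ)) := by
  obtain ⟨z, hz, hle⟩ := h
  rw [← RHHeightClassGlue.absRamificationIdx_kOf X p x] at he ⊢
  exact exponent_le_of_mem_logUnits_of_tame p hp2 he hz hle

end Place

/-! ## §2. The row-15 clause with all donors at the bad place FAILS once `(j−1)·m_q ≥ e` (pinned dictionary `n₀ ≤ 1`, `λ ≤ −1/e`) -/

/-- **INTEGER ARITHMETIC OF THE FAILURE.** `e ≥ 1`, `n₀ ≤ 1`, `λ ≤ −1/e`, `j = i+1`, `e ≤ i·m_q`: the clause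
`⌊(j²·m_q − n₀)/e⌋ ≤ m_q/e + λ + Σ_{a < j} (λ + ⌈n₀/e⌉)` of abc-iut-lens-wuc-1's `SlotReachWindow` (donors all at the same place) is FALSE —
`e·⌊x/e⌋ ≥ x − e + 1`, `⌈n₀/e⌉ ≤ 1`, so it would give `(j²−1)·m_q ≤ (j+1)(e−1)`, i.e. `i·m_q ≤ e − 1`. [folklore] -/
theorem not_slotClause_of_heavy {e n₀ i : ℕ} {lam : ℝ} {mq : ℤ} (he : 1 ≤ e) (hn₀ : n₀ ≤ 1) (hlam : lam ≤ -(1 / (e : ℝ)))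
    (hheavy : (e : ℤ) ≤ (i : ℤ) * mq) :
    ¬ ((((((i : ℤ) + 1) ^ 2 * mq - (n₀ : ℤ)) / (e : ℤ) : ℤ) : ℝ) ≤ (mq : ℝ) / (e : ℝ) + lam
        + ∑ _a : Fin (i + 1), (lam + ((-((-(n₀ : ℤ)) / (e : ℤ)) : ℤ) : ℝ))) := by
  intro hc
  have he0 : (0 : ℝ) < e := by exact_mod_cast he
  have heZ : (0 : ℤ) < e := by exact_mod_cast he
  set A : ℤ := ((i : ℤ) + 1) ^ 2 * mq - (n₀ : ℤ) with hA
  set q : ℤ := A / (e : ℤ) with hq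
  set c : ℤ := -((-(n₀ : ℤ)) / (e : ℤ)) with hcdef
  -- floor: `e·⌊A/e⌋ ≥ A − e + 1`
  have hfloor : A - (e : ℤ) + 1 ≤ (e : ℤ) * q := by
    have h1 := Int.mul_ediv_add_emod A (e : ℤ)
    have h2 := Int.emod_lt_of_pos A heZ
    rw [hq]
    linarith
  -- ceiling: `⌈n₀/e⌉ ≤ 1`
  have hceil : c ≤ 1 := by
    have h1 : (-(e : ℤ)) / (e : ℤ) ≤ (-(n₀ : ℤ)) / (e : ℤ) := Int.ediv_le_ediv heZ (by omega)
    have h2 : (-(e : ℤ)) / (e : ℤ) = -1 := by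
      rw [Int.neg_ediv_of_dvd (dvd_refl _), Int.ediv_self heZ.ne']
    rw [hcdef]
    omega
  -- the sum is `(i+1)·(λ + c)`
  rw [Finset.sum_const, Finset.card_univ, Fintype.card_fin, nsmul_eq_mul] at hc
  push_cast at hc
  -- multiply the clause by `e`: `e·q ≤ m_q + (i+2)·(e·λ) + (i+1)·(e·c) ≤ m_q − (i+2) + (i+1)·(e·c)`
  have hlam' : (e : ℝ) * lam ≤ -1 := by
    have h := mul_le_mul_of_nonneg_left hlam he0.le
    rwa [mul_neg, mul_one_div_cancel he0.ne'] at h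
  have h1 : (e : ℝ) * (q : ℝ) ≤ (e : ℝ) * ((mq : ℝ) / (e : ℝ) + lam + ((i : ℝ) + 1) * (lam + (c : ℝ))) :=
    mul_le_mul_of_nonneg_left hc he0.le
  have h2 : (e : ℝ) * ((mq : ℝ) / (e : ℝ) + lam + ((i : ℝ) + 1) * (lam + (c : ℝ))) =
      (mq : ℝ) + ((i : ℝ) + 2) * ((e : ℝ) * lam) + ((i : ℝ) + 1) * ((e : ℝ) * (c : ℝ)) := by
    field_simp
    ring
  have h3 : ((i : ℝ) + 2) * ((e : ℝ) * lam) ≤ ((i : ℝ) + 2) * (-1) := mul_le_mul_of_nonneg_left hlam' (by positivity)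
  have hR : ((e : ℤ) * q : ℝ) ≤ ((mq - ((i : ℤ) + 2) + ((i : ℤ) + 1) * ((e : ℤ) * c) : ℤ) : ℝ) := by
    push_cast
    linarith
  have hZ : (e : ℤ) * q ≤ mq - ((i : ℤ) + 2) + ((i : ℤ) + 1) * ((e : ℤ) * c) := by exact_mod_cast hR
  -- `(i+1)·(e·c) ≤ (i+1)·e` and the floor give `i·(i+2)·m_q ≤ (i+2)·(e−1)`
  have h4 : ((i : ℤ) + 1) * ((e : ℤ) * c) ≤ ((i : ℤ) + 1) * (e : ℤ) := by
    have : (e : ℤ) * c ≤ (e : ℤ) := by nlinarith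
    nlinarith
  have hn₀' : (n₀ : ℤ) ≤ 1 := by exact_mod_cast hn₀
  have h5 : ((i : ℤ) + 2) * ((i : ℤ) * mq) ≤ ((i : ℤ) + 2) * ((e : ℤ) - 1) := by
    have hA' : A = ((i : ℤ) + 2) * ((i : ℤ) * mq) + mq - (n₀ : ℤ) := by rw [hA]; ring
    nlinarith
  have h6 : (i : ℤ) * mq ≤ (e : ℤ) - 1 := le_of_mul_le_mul_left h5 (by positivity)
  omega

/-! ## §3. At the genuine `K`-level datum: a TAME bad place with `4·l·e(v|p) ≤ (l−3)·ord_v(q_v)` is outside Σ₁₅ for EVERY certified dictionary -/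

section Genuine

variable {F K Fbar : Type} [Field F] [NumberField F] [Field K] [NumberField K] [Algebra F K] [Field Fbar]
  [Algebra F Fbar] [Algebra K Fbar] {E : WeierstrassCurve F} [E.IsElliptic] {l : ℕ} {Pb : BadPlacePredicates K}
  (D : InitialThetaData F K Fbar E l Pb)

/-- **OUT OF Σ₁₅ AT A HEAVY TAME PLACE, WHATEVER THE CERTIFICATES.** `D` a [IUTchI] Def. 3.1 datum, `x₀ ∣ p` a BAD place of the `K`-level pilot
datum `pilotDataOfK D K` with `p > 2`, `e_{x₀} ≤ p − 2` (tame) and `4·l·e(v|p) ≤ (l−3)·ord_v(q_v)` at the place `v` of `F` under it: for EVERY integer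
Kummer-order function `m_q` realising `P_q` on the bad places, EVERY inner-conductor function `n₀` certified by non-members and EVERY outer-radius
function `λ` certified by members, the row-15 window `SlotReachWindowK D ramIdx n₀ λ (j²·m_q) m_q` FAILS — at the cell `(x₀, j = l⋆)` with all donors
at `x₀`: §1 pins `n₀(x₀) ≤ 1`, `λ_{x₀} ≤ −1/e_{x₀}`; `2l·m_q(x₀) = e(x₀|v)·ord_v(q_v)` ([IUTchI] Ex. 3.2 (iv)), `e_{x₀} = e(v|p)·e(x₀|v)`, `2(l⋆−1) = l−3`
give `(l⋆−1)·m_q(x₀) ≥ e_{x₀}`; §2. [cite: Mochizuki2012, IUTchI Def. 3.1 (b)(c) pp. 61–62, Ex. 3.2 (iv) p. 71; IUTchIV Prop. 1.2 (i) p. 10, Prop. 1.4 (ii) p. 13]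
[cite: NeukirchANT1999, Ch. II Prop. (5.5)] [claim: Mochizuki2012, status: disputed] -/
theorem not_slotReachWindowK_of_heavy_tame (pp : Nat.Primes) (hp2 : 2 < (pp : ℕ))
    (x₀ : (thetaIndex (pilotDataOfK D K)).Fibre (.inr pp))
    (hx₀ : haveI : Fact (pp : ℕ).Prime := ⟨pp.2⟩; placeOf (pilotDataOfK D K) pp.1 x₀ ∈ (pilotDataOfK D K).S)
    (htame : haveI : Fact (pp : ℕ).Prime := ⟨pp.2⟩; ramIdx K (placeOf (pilotDataOfK D K) pp.1 x₀) ≤ (pp : ℕ) - 2)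
    (hheavy : haveI : Fact (pp : ℕ).Prime := ⟨pp.2⟩;
      4 * l * ramIdx F (finBelow F K (placeOf (pilotDataOfK D K) pp.1 x₀)) ≤
        (l - 3) * qParamOrd E (finBelow F K (placeOf (pilotDataOfK D K) pp.1 x₀)))
    (mq : ∀ pp : Nat.Primes, (thetaIndex (pilotDataOfK D K)).Fibre (.inr pp) → ℤ)
    (hmq : ∀ (pp : Nat.Primes) (w : (thetaIndex (pilotDataOfK D K)).Fibre (.inr pp)), haveI : Fact (pp : ℕ).Prime := ⟨pp.2⟩;
      placeOf (pilotDataOfK D K) pp.1 w ∈ (pilotDataOfK D K).S →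
        (mq pp w : ℝ) = (pilotDataOfK D K).qPilot (placeOf (pilotDataOfK D K) pp.1 w))
    (n₀ : ∀ pp : Nat.Primes, (thetaIndex (pilotDataOfK D K)).Fibre (.inr pp) → ℕ)
    (hn₀ : ∀ (pp : Nat.Primes) (x : (thetaIndex (pilotDataOfK D K)).Fibre (.inr pp)), haveI : Fact (pp : ℕ).Prime := ⟨pp.2⟩;
      ∃ u : kOf (pilotDataOfK D K) pp.1 x,
        ‖u‖ ≤ (pp : ℝ) ^ (-(((n₀ pp x : ℤ) - 1 : ℤ) : ℝ) / (ramIdx K (placeOf (pilotDataOfK D K) pp.1 x) : ℝ)) ∧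
        u ∉ (logUnits (kOf (pilotDataOfK D K) pp.1 x) : Set (kOf (pilotDataOfK D K) pp.1 x)))
    (lam : ∀ pp : Nat.Primes, (thetaIndex (pilotDataOfK D K)).Fibre (.inr pp) → ℝ)
    (hlam : ∀ (pp : Nat.Primes) (x : (thetaIndex (pilotDataOfK D K)).Fibre (.inr pp)), haveI : Fact (pp : ℕ).Prime := ⟨pp.2⟩;
      ∃ z ∈ (logUnits (kOf (pilotDataOfK D K) pp.1 x) : Set (kOf (pilotDataOfK D K) pp.1 x)), (pp : ℝ) ^ (lam pp x) ≤ ‖z‖) :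
    ¬ SlotReachWindowK D (fun pp x => haveI : Fact (pp : ℕ).Prime := ⟨pp.2⟩; ramIdx K (placeOf (pilotDataOfK D K) pp.1 x)) n₀ lam
        (fun pp i w => ((((i : ℕ) : ℤ) + 1) ^ 2) * mq pp w) mq := by
  haveI : Fact (pp : ℕ).Prime := ⟨pp.2⟩
  intro hW
  set w := placeOf (pilotDataOfK D K) pp.1 x₀ with hwdef
  set v := finBelow F K w with hvdef
  -- the top label `i = l⋆ − 1`, `l⋆ = (l−1)/2`
  have hls : (pilotDataOfK D K).lstar = (l - 1) / 2 := by
    unfold PilotData.lstar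
    rw [pilotDataOfK_l]
  have h5 : 5 ≤ l := D.five_le_l
  have hodd : ¬ 2 ∣ l := fun h => by
    have := (Nat.prime_dvd_prime_iff_eq Nat.prime_two D.l_prime).1 h
    omega
  set i : Fin (thetaIndex (pilotDataOfK D K)).lstar :=
    ⟨(l - 1) / 2 - 1, by change (l - 1) / 2 - 1 < (pilotDataOfK D K).lstar; rw [hls]; omega⟩ with hidef
  have hi : ((i : ℕ) : ℤ) = (((l - 1) / 2 - 1 : ℕ) : ℤ) := rfl
  -- the clause at `(x₀, i)` with every donor at `x₀`
  have hc := hW pp i x₀ hx₀ (fun _ => x₀)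
  dsimp only at hc
  -- the certificates at the tame place `x₀`
  have hn₀' : n₀ pp x₀ ≤ 1 := natConductor_le_one_placeOf (pilotDataOfK D K) pp.1 hp2 x₀ htame (hn₀ pp x₀)
  have hlam' : lam pp x₀ ≤ -(1 / (ramIdx K w : ℝ)) := exponent_le_placeOf (pilotDataOfK D K) pp.1 hp2 x₀ htame (hlam pp x₀)
  -- the integer Kummer order at `x₀` and the heavy inequality `e_w ≤ (l⋆−1)·m_q(x₀)`
  obtain ⟨P, hP, -, h2lP⟩ := exists_nat_qPilot_pilotDataOfK D hx₀
  have hmqP : mq pp x₀ = (P : ℤ) := by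
    have h := hmq pp x₀ hx₀
    rw [hP] at h
    exact_mod_cast h
  have he1 : 1 ≤ ramIdx K w := Nat.one_le_iff_ne_zero.2 (ramIdx_ne_zero K w)
  have hew : ramIdx K w = ramIdx F v * Ideal.ramificationIdx' v.asIdeal w.asIdeal := by
    rw [ramIdx_eq, ThetaData.absRamificationIdx_eq_ramIdx_mul (F := F) w]
    rfl
  have hheavy' : (ramIdx K w : ℤ) ≤ ((i : ℕ) : ℤ) * mq pp x₀ := by
    rw [hmqP]
    have h2i : 2 * (i : ℕ) = l - 3 := by
      change 2 * ((l - 1) / 2 - 1) = l - 3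
      omega
    -- `2l·ramIdx F v ≤ i·ord_v(q_v)` from `4l·ramIdx F v ≤ (l−3)·ord_v(q_v)`
    have hA : 2 * (2 * l * ramIdx F v) ≤ 2 * ((i : ℕ) * qParamOrd E v) := by
      calc 2 * (2 * l * ramIdx F v) = 4 * l * ramIdx F v := by ring
        _ ≤ (l - 3) * qParamOrd E v := hheavy
        _ = 2 * ((i : ℕ) * qParamOrd E v) := by rw [← h2i]; ring
    have hB : 2 * l * ramIdx F v ≤ (i : ℕ) * qParamOrd E v := Nat.le_of_mul_le_mul_left hA (by norm_num)
    -- multiply by `e(w|v)` and use `2l·P = e(w|v)·ord_v(q_v)`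
    have hC : 2 * l * ramIdx K w ≤ 2 * l * ((i : ℕ) * P) := by
      calc 2 * l * ramIdx K w = (2 * l * ramIdx F v) * Ideal.ramificationIdx' v.asIdeal w.asIdeal := by rw [hew]; ring
        _ ≤ ((i : ℕ) * qParamOrd E v) * Ideal.ramificationIdx' v.asIdeal w.asIdeal := Nat.mul_le_mul_right _ hB
        _ = (i : ℕ) * (Ideal.ramificationIdx' v.asIdeal w.asIdeal * qParamOrd E v) := by ring
        _ = (i : ℕ) * (2 * l * P) := by rw [← h2lP]
        _ = 2 * l * ((i : ℕ) * P) := by ring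
    have hD : ramIdx K w ≤ (i : ℕ) * P := Nat.le_of_mul_le_mul_left hC (by omega)
    exact_mod_cast hD
  exact not_slotClause_of_heavy he1 hn₀' hlam' hheavy' hc

end Genuine

/-! ## §4. Every genuine Θ-volume datum over a rational point with a tame pole prime `p ≥ 30l + 2` of height `h ≥ 4l/(l−3)` is outside Σ₁₅ -/

section Out

/-- **OUT OF Σ₁₅ AT A RATIONAL POINT WITH A LARGE TAME POLE PRIME.** `λ ∈ ℚ`, `T` a genuine Θ-volume datum at `(ratPoint λ, l)` (`l` prime),
`p ∉ {2, 3, 5, l}` a prime with `30·l + 2 ≤ p` at which `j(λ)` has a pole of exact order `h ≥ 1` with `4·l ≤ (l − 3)·h`: NO certified row-15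
dictionary exists — for every realising `m_q`, every certified `n₀`, `λ`: `¬ SlotReachWindowK`. The bad place `x₀ ∣ p` of
`UniformWitness.exists_heavy_place_ratPoint_of_pole` (g3, p493967) has `e_{x₀} ≤ 30·l ≤ p − 2` (abc-iut-W-neg-1's ramification bound) and
`ord_v(q_v) = e(v|p)·h`; §3. [cite: Mochizuki2012, IUTchI Def. 3.1 (b)(c) pp. 61–62; IUTchIV Prop. 1.2 (i) p. 10, Prop. 1.4 (ii) p. 13, Thm. 1.10
Steps (ii)–(iii) pp. 24–26] [cite: SerreLocalFields1979, Ch. IV §2 Cor. 1 of Prop. 7] [claim: Mochizuki2012, status: disputed] -/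
theorem not_slotReachWindowK_ratPoint_of_pole {q : ℚ} {l : ℕ} (T : ThetaVolumeDatumAt (ratPoint q) l) (hP : ratPoint q ∈ UP) (hl : l.Prime)
    (pp : Nat.Primes) (hp2 : (pp : ℕ) ≠ 2) (hp3 : (pp : ℕ) ≠ 3) (hp5 : (pp : ℕ) ≠ 5) (hpl : (pp : ℕ) ≠ l) (h30 : 30 * l + 2 ≤ (pp : ℕ))
    {h : ℕ} (hh : 0 < h) (hord : ∀ u : HeightOneSpectrum (𝓞 ℚ), natGenerator u = (pp : ℕ) → ord ℚ u (jInv q) = -(h : ℤ))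
    (hineq : 4 * l ≤ (l - 3) * h) :
    letI := T.instFieldF; letI := T.instNumberFieldF; letI := T.instAlgebraF; letI := T.instFieldK
    letI := T.instNumberFieldK; letI := T.instAlgebraK; letI := T.instFieldFbar; letI := T.instAlgebraFbar
    letI := T.instAlgebraKFbar; letI := T.instIsElliptic
    ∀ (mq : ∀ pp : Nat.Primes, (thetaIndex (pilotDataOfK T.D T.K)).Fibre (.inr pp) → ℤ),
      (∀ (pp : Nat.Primes) (w : (thetaIndex (pilotDataOfK T.D T.K)).Fibre (.inr pp)), haveI : Fact (pp : ℕ).Prime := ⟨pp.2⟩;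
        placeOf (pilotDataOfK T.D T.K) pp.1 w ∈ (pilotDataOfK T.D T.K).S →
          (mq pp w : ℝ) = (pilotDataOfK T.D T.K).qPilot (placeOf (pilotDataOfK T.D T.K) pp.1 w)) →
    ∀ (n₀ : ∀ pp : Nat.Primes, (thetaIndex (pilotDataOfK T.D T.K)).Fibre (.inr pp) → ℕ),
      (∀ (pp : Nat.Primes) (x : (thetaIndex (pilotDataOfK T.D T.K)).Fibre (.inr pp)), haveI : Fact (pp : ℕ).Prime := ⟨pp.2⟩;
        ∃ u : kOf (pilotDataOfK T.D T.K) pp.1 x,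
          ‖u‖ ≤ (pp : ℝ) ^ (-(((n₀ pp x : ℤ) - 1 : ℤ) : ℝ) / (ramIdx T.K (placeOf (pilotDataOfK T.D T.K) pp.1 x) : ℝ)) ∧
          u ∉ (logUnits (kOf (pilotDataOfK T.D T.K) pp.1 x) : Set (kOf (pilotDataOfK T.D T.K) pp.1 x))) →
    ∀ (lam : ∀ pp : Nat.Primes, (thetaIndex (pilotDataOfK T.D T.K)).Fibre (.inr pp) → ℝ),
      (∀ (pp : Nat.Primes) (x : (thetaIndex (pilotDataOfK T.D T.K)).Fibre (.inr pp)), haveI : Fact (pp : ℕ).Prime := ⟨pp.2⟩;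
        ∃ z ∈ (logUnits (kOf (pilotDataOfK T.D T.K) pp.1 x) : Set (kOf (pilotDataOfK T.D T.K) pp.1 x)), (pp : ℝ) ^ (lam pp x) ≤ ‖z‖) →
    ¬ SlotReachWindowK T.D (fun pp x => haveI : Fact (pp : ℕ).Prime := ⟨pp.2⟩; ramIdx T.K (placeOf (pilotDataOfK T.D T.K) pp.1 x)) n₀ lam
        (fun pp i w => ((((i : ℕ) : ℤ) + 1) ^ 2) * mq pp w) mq := by
  letI := T.instFieldF; letI := T.instNumberFieldF; letI := T.instAlgebraF; letI := T.instFieldK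
  letI := T.instNumberFieldK; letI := T.instAlgebraK; letI := T.instFieldFbar; letI := T.instAlgebraFbar
  letI := T.instAlgebraKFbar; letI := T.instIsElliptic
  haveI : Fact (pp : ℕ).Prime := ⟨pp.2⟩
  intro mq hmq n₀ hn₀ lam hlam
  obtain ⟨x₀, hx₀S, hB, hq⟩ := exists_heavy_place_ratPoint_of_pole T hP hl pp hp2 hp3 hp5 hpl hh hord
  refine not_slotReachWindowK_of_heavy_tame T.D pp (by omega) x₀ hx₀S (by omega) ?_ mq hmq n₀ hn₀ lam hlam
  rw [hq]
  set e := ramIdx T.F (finBelow T.F T.K (placeOf (pilotDataOfK T.D T.K) pp.1 x₀)) with hedef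
  calc 4 * l * e ≤ ((l - 3) * h) * e := Nat.mul_le_mul_right _ hineq
    _ = (l - 3) * (e * h) := by ring

end Out

/-! ## §5. «NOT UNIFORMLY» for row 15: no `l₀` serves all Galois data (a fortiori all data) -/

/-- **Q3 (row 15), UNIFORM READING OVER GALOIS DATA — REFUTED UNCONDITIONALLY.** There is NO `l₀` such that every [IUTchI] Def. 3.1 datum of every
level `l ≥ l₀` over every curve, with `K/ℚ` Galois, admits certified row-15 parameters `(m_q, n₀, λ)` with `SlotReachWindowK D ramIdx n₀ λ (j²·m_q) m_q` —
the literal uniformisation (`∃ l₀` before `∀ (F, E)`) of the PROVED per-curve target `LTailSigma15` (p481995). Witness at a given `l₀`: prime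
`l ≡ 3 (mod 4)`, `l > max(l₀, 160)` (Dirichlet); prime `r ∈ (30l+1, 60l+2]` (Bertrand); `λ_r = r⁸/(r⁸+1)` — `UP`, `AdmitsCore`, (P2), (P5), (P6) by this
lineage's `UniformWitness.*` (p488771/p489180); the genuine datum of `UniformWitness.exists_thetaVolumeDatumAt_isGalois` (p493238, `K = F‡(λ_r)(E[l])`
Galois over `ℚ`); §4 at `p = r ≥ 30l + 2`, `h = 16`, `4l ≤ 16(l−3)`. No abc claim; no side on [IUTchIII] Cor. 3.12; `SlotReachWindowK` = row 15's
hypothesis vocabulary; refuted-as-typed ≠ refuted-in-print. [cite: Mochizuki2012, IUTchI Def. 3.1 (b)(c) pp. 61–62, Ex. 3.2 (iv) p. 71; IUTchIV Prop. 1.2 (i)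
p. 10, Prop. 1.4 (ii) p. 13, Cor. 2.2 (ii) proof (P2)(P5)(P6)(P7) pp. 45–46] [cite: Mazur1978, §6 Prop. 6.3 (1) p. 153] [claim: Mochizuki2012, status: disputed] -/
theorem not_exists_uniform_l0_slotReachWindowK_isGalois :
    ¬ ∃ l₀ : ℕ, ∀ l : ℕ, l₀ ≤ l →
      ∀ (F : Type) [Field F] [NumberField F] (E : WeierstrassCurve F) [E.IsElliptic]
        (K Fbar : Type) [Field K] [NumberField K] [Algebra F K] [Field Fbar] [Algebra F Fbar] [Algebra K Fbar]
        (Pb : BadPlacePredicates K) (D : InitialThetaData F K Fbar E l Pb), IsGalois ℚ K →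
        ∃ (mq : ∀ pp : Nat.Primes, (thetaIndex (pilotDataOfK D K)).Fibre (.inr pp) → ℤ)
          (n₀ : ∀ pp : Nat.Primes, (thetaIndex (pilotDataOfK D K)).Fibre (.inr pp) → ℕ)
          (lam : ∀ pp : Nat.Primes, (thetaIndex (pilotDataOfK D K)).Fibre (.inr pp) → ℝ),
          (∀ (pp : Nat.Primes) (w : (thetaIndex (pilotDataOfK D K)).Fibre (.inr pp)), haveI : Fact (pp : ℕ).Prime := ⟨pp.2⟩;
            placeOf (pilotDataOfK D K) pp.1 w ∈ (pilotDataOfK D K).S →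
              (mq pp w : ℝ) = (pilotDataOfK D K).qPilot (placeOf (pilotDataOfK D K) pp.1 w)) ∧
          (∀ (pp : Nat.Primes) (x : (thetaIndex (pilotDataOfK D K)).Fibre (.inr pp)), haveI : Fact (pp : ℕ).Prime := ⟨pp.2⟩;
            ∃ u : kOf (pilotDataOfK D K) pp.1 x,
              ‖u‖ ≤ (pp : ℝ) ^ (-(((n₀ pp x : ℤ) - 1 : ℤ) : ℝ) / (ramIdx K (placeOf (pilotDataOfK D K) pp.1 x) : ℝ)) ∧
              u ∉ (logUnits (kOf (pilotDataOfK D K) pp.1 x) : Set (kOf (pilotDataOfK D K) pp.1 x))) ∧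
          (∀ (pp : Nat.Primes) (x : (thetaIndex (pilotDataOfK D K)).Fibre (.inr pp)), haveI : Fact (pp : ℕ).Prime := ⟨pp.2⟩;
            ∃ z ∈ (logUnits (kOf (pilotDataOfK D K) pp.1 x) : Set (kOf (pilotDataOfK D K) pp.1 x)), (pp : ℝ) ^ (lam pp x) ≤ ‖z‖) ∧
          SlotReachWindowK D (fun pp x => haveI : Fact (pp : ℕ).Prime := ⟨pp.2⟩; ramIdx K (placeOf (pilotDataOfK D K) pp.1 x)) n₀ lam
            (fun pp i w => ((((i : ℕ) : ℤ) + 1) ^ 2) * mq pp w) mq := by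
  rintro ⟨l₀, hall⟩
  -- a prime `l ≡ 3 (mod 4)` beyond `max l₀ 160`
  obtain ⟨l, hlgt, hl, hmod⟩ := Nat.forall_exists_prime_gt_and_modEq (max l₀ 160) (q := 4) (a := 3) (by norm_num) (by norm_num)
  have hl0 : l₀ ≤ l := le_trans (le_max_left _ _) hlgt.le
  have hl160 : 160 ≤ l := le_trans (le_max_right _ _) hlgt.le
  have hmod' : l % 4 = 3 := hmod
  -- a prime `r` with `30·l + 1 < r ≤ 60·l + 2` (so that `e ≤ 30l ≤ r − 2` at the witness place)
  obtain ⟨r, hr, h30, h60⟩ := Nat.exists_prime_lt_and_le_two_mul (30 * l + 1) (by omega)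
  have hr2 : r ≠ 2 := by omega
  have hr5 : r ≠ 5 := by omega
  have hrl : r ≠ l := by omega
  have h3l : r ^ 8 + 1 < 3 ^ l := pow_eight_succ_lt_three_pow hl160 (by omega)
  -- the genuine Θ-volume datum at `(ratPoint λ_r, l)` with `K/ℚ` Galois
  obtain ⟨T, hGal⟩ := exists_thetaVolumeDatumAt_isGalois (mem_UP r hr.pos) hl (by omega) (admitsCore r hr (by omega))
    (condP2 r hr hr2 hl (by omega) h3l) (condP5 r hr hr2 hl hrl) (condP6 r hr hr2 hr5 hl (by omega) hmod' hrl)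
  letI := T.instFieldF; letI := T.instNumberFieldF; letI := T.instAlgebraF; letI := T.instFieldK
  letI := T.instNumberFieldK; letI := T.instAlgebraK; letI := T.instFieldFbar; letI := T.instAlgebraFbar
  letI := T.instAlgebraKFbar; letI := T.instIsElliptic
  obtain ⟨mq, n₀, lam, hmq, hn₀, hlam, hW⟩ := hall l hl0 T.F T.E T.K T.Fbar T.Pb T.D hGal
  exact not_slotReachWindowK_ratPoint_of_pole T (mem_UP r hr.pos) hl ⟨r, hr⟩ (by change r ≠ 2; omega) (by change r ≠ 3; omega)
    (by change r ≠ 5; omega) (by change r ≠ l; omega) (by change 30 * l + 2 ≤ r; omega) (h := 16) (by norm_num)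
    (fun u hu => by rw [ord_jInv_of_natGenerator_eq r hr hr2 u hu]; norm_num) (by omega) mq hmq n₀ hn₀ lam hlam hW

/-- **ROW 15, BOTH HALVES SIDE BY SIDE: «YES PER CURVE, NOT UNIFORMLY».** Every curve `(F, E)` has its own `l₀(E)` (`lTailSigma15_holds`, p481995),
and no `l₀` serves all curves (`not_exists_uniform_l0_slotReachWindowK_isGalois`). [claim: Mochizuki2012, status: disputed] -/
theorem perCurve_and_not_uniform :
    (∀ (F : Type) [Field F] [NumberField F] (E : WeierstrassCurve F) [E.IsElliptic], LTailSigma15 F E) ∧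
    ¬ ∃ l₀ : ℕ, ∀ l : ℕ, l₀ ≤ l →
      ∀ (F : Type) [Field F] [NumberField F] (E : WeierstrassCurve F) [E.IsElliptic]
        (K Fbar : Type) [Field K] [NumberField K] [Algebra F K] [Field Fbar] [Algebra F Fbar] [Algebra K Fbar]
        (Pb : BadPlacePredicates K) (D : InitialThetaData F K Fbar E l Pb), IsGalois ℚ K →
        ∃ (mq : ∀ pp : Nat.Primes, (thetaIndex (pilotDataOfK D K)).Fibre (.inr pp) → ℤ)
          (n₀ : ∀ pp : Nat.Primes, (thetaIndex (pilotDataOfK D K)).Fibre (.inr pp) → ℕ)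
          (lam : ∀ pp : Nat.Primes, (thetaIndex (pilotDataOfK D K)).Fibre (.inr pp) → ℝ),
          (∀ (pp : Nat.Primes) (w : (thetaIndex (pilotDataOfK D K)).Fibre (.inr pp)), haveI : Fact (pp : ℕ).Prime := ⟨pp.2⟩;
            placeOf (pilotDataOfK D K) pp.1 w ∈ (pilotDataOfK D K).S →
              (mq pp w : ℝ) = (pilotDataOfK D K).qPilot (placeOf (pilotDataOfK D K) pp.1 w)) ∧
          (∀ (pp : Nat.Primes) (x : (thetaIndex (pilotDataOfK D K)).Fibre (.inr pp)), haveI : Fact (pp : ℕ).Prime := ⟨pp.2⟩;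
            ∃ u : kOf (pilotDataOfK D K) pp.1 x,
              ‖u‖ ≤ (pp : ℝ) ^ (-(((n₀ pp x : ℤ) - 1 : ℤ) : ℝ) / (ramIdx K (placeOf (pilotDataOfK D K) pp.1 x) : ℝ)) ∧
              u ∉ (logUnits (kOf (pilotDataOfK D K) pp.1 x) : Set (kOf (pilotDataOfK D K) pp.1 x))) ∧
          (∀ (pp : Nat.Primes) (x : (thetaIndex (pilotDataOfK D K)).Fibre (.inr pp)), haveI : Fact (pp : ℕ).Prime := ⟨pp.2⟩;
            ∃ z ∈ (logUnits (kOf (pilotDataOfK D K) pp.1 x) : Set (kOf (pilotDataOfK D K) pp.1 x)), (pp : ℝ) ^ (lam pp x) ≤ ‖z‖) ∧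
          SlotReachWindowK D (fun pp x => haveI : Fact (pp : ℕ).Prime := ⟨pp.2⟩; ramIdx K (placeOf (pilotDataOfK D K) pp.1 x)) n₀ lam
            (fun pp i w => ((((i : ℕ) : ℤ) + 1) ^ 2) * mq pp w) mq :=
  ⟨fun F _ _ E _ => lTailSigma15_holds F E, not_exists_uniform_l0_slotReachWindowK_isGalois⟩

end Uniform

end Summit.ABC.IUTFork.Repair.RH.Q3LTailSigma15

end
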